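import Summits.CriticalPhenomena.PercolationContinuityZ3.Theorems.PercNearOneGluingNoHeavyQuantFarRelayRowStar
import Summits.CriticalPhenomena.PercolationContinuityZ3.Theorems.PercNearOneGluingNoHeavyQuantIndepBlobThinning
import HarnessLib

/-!
# QUANT lane R8 tool: the block sum of `Quant.HubBlocksProfileIneq` read as an independent-blob system on the block coordinates
# (measure form ↔ the Finset-weight vocabulary of `…QuantIndepBlob*.lean`)

builds on p205010 (kernel theorem, internal audit signed; external expert review pending)

Support file (`--supports stmt-CriticalPhenomena-4575`), QUANT lane typer seat prim-quant-stmt (gen 15); step S0 of the assembly of the profile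
conjecture `Quant.HubBlocksProfileIneq` (`…QuantHubBlocksProfileConjecture.lean`; census-1 PROFILE-PROOF-G10 §2–§5/§11, all of whose blob-sum inputs —
`IndepBlob.far_indepBlob_min`, `IndepBlob.halfRow`, `IndepBlob.hubMixture_far`, `IndepBlob.twoPointHub_vertex`, `Quant.ratioRegular_expectation_ge` — are
kernel theorems in the Finset-weight vocabulary on an abstract blob type `κ`).  The conjecture itself speaks of `(prodBernoulli q).real {ω | y ≤ W ω}`,
`W ω = Σ_{x ∈ K, x ∈ ω} size x`, on `Set (Fin n)`; this file identifies the two once.  Theorems only; no definitions, no sorries, standard axioms.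

* `Quant.sum_weight_eq_sum_powerset_inter` — a functional of `s ∩ K` integrates against the product weights on `Fin n` as against the product
  weights on `K` alone (the coordinates off `K` sum out to `1`).
* `Quant.sum_powerset_eq_sum_finset_subtype` — re-indexing `K.powerset` by `Finset ↥K`.
* `Quant.real_blockTail_eq_sum_subtype` — **`P(y ≤ W) = Σ_{T ⊆ ↥K : y ≤ Σ_{k∈T} size k} ∏_{k : ↥K} (q k if k ∈ T else 1 − q k)`**, the form in which
  `IndepBlob.halfRow` / `twoPointHub_vertex` / `hubMixture_far` (blob type `↥K`, gates `q ∘ val`, sizes `size ∘ val`) are stated; with a shift,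
  `Quant.real_blockTail_shift_eq_sum_subtype`: `P(y − M ≤ W) = Σ_{T : y ≤ M + Σ_T size} …` (natural subtraction, as in the conjecture's `j + 1 − b`).
[cite: Grimmett1999, §1.3 p. 10] (product measure); [this work].
-/

noncomputable section

namespace Summit.CriticalPhenomena.PercolationContinuityZ3.Theorems

namespace Quant

open Finset MeasureTheory
open Literature.Probability.LatticeModels
open Literature.Probability.Percolation
open scoped Classical

variable {n : ℕ}

/-- **Coordinates off `K` integrate out.**  For any functional `F` of the trace `s ∩ K` and any real gate vector `w`:
`Σ_{s ⊆ Fin n} F(s ∩ K)·∏_x (w x if x ∈ s else 1 − w x) = Σ_{T ⊆ K} F T·∏_{x∈K} (w x if x ∈ T else 1 − w x)`. [folklore] -/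
theorem sum_weight_eq_sum_powerset_inter (K : Finset (Fin n)) (w : Fin n → ℝ) (F : Finset (Fin n) → ℝ) :
    ∑ s : Finset (Fin n), F (s ∩ K) * ∏ x, (if x ∈ s then w x else 1 - w x) =
      ∑ T ∈ K.powerset, F T * ∏ x ∈ K, (if x ∈ T then w x else 1 - w x) := by
  -- group the configurations by their trace on `K`
  rw [← Finset.sum_fiberwise_of_maps_to (s := (Finset.univ : Finset (Finset (Fin n)))) (t := K.powerset) (g := fun s => s ∩ K)
    (fun s _ => Finset.mem_powerset.2 Finset.inter_subset_right)]
  refine Finset.sum_congr rfl fun T hT => ?_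
  have hTK : T ⊆ K := Finset.mem_powerset.1 hT
  -- on the fibre `s ∩ K = T` the weight splits as (weight of `T` on `K`) · (weight of `s \ K` on `Kᶜ`)
  have hfib : ∀ s ∈ (Finset.univ : Finset (Finset (Fin n))).filter (fun s => s ∩ K = T),
      F (s ∩ K) * ∏ x, (if x ∈ s then w x else 1 - w x) =
        F T * ((∏ x ∈ K, (if x ∈ T then w x else 1 - w x)) * ∏ x ∈ Kᶜ, (if x ∈ s \ K then w x else 1 - w x)) := by
    intro s hs
    have hsT : s ∩ K = T := (Finset.mem_filter.1 hs).2
    rw [hsT, ← Finset.prod_mul_prod_compl K (fun x => if x ∈ s then w x else 1 - w x)]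
    congr 1
    congr 1
    · refine Finset.prod_congr rfl fun x hx => ?_
      have : x ∈ s ↔ x ∈ T := by rw [← hsT, Finset.mem_inter]; exact ⟨fun h => ⟨h, hx⟩, fun h => h.1⟩
      simp only [this]
    · refine Finset.prod_congr rfl fun x hx => ?_
      have hxK : x ∉ K := Finset.mem_compl.1 hx
      have : x ∈ s ↔ x ∈ s \ K := by rw [Finset.mem_sdiff]; exact ⟨fun h => ⟨h, hxK⟩, fun h => h.1⟩
      simp only [this]
  rw [Finset.sum_congr rfl hfib, ← Finset.mul_sum, ← Finset.mul_sum]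
  -- the fibre is in bijection with `Kᶜ.powerset` via `s ↦ s \ K`, and the `Kᶜ`-weights sum to one
  have hone : ∑ s ∈ (Finset.univ : Finset (Finset (Fin n))).filter (fun s => s ∩ K = T),
      ∏ x ∈ Kᶜ, (if x ∈ s \ K then w x else 1 - w x) = 1 := by
    have hbij : ∑ s ∈ (Finset.univ : Finset (Finset (Fin n))).filter (fun s => s ∩ K = T),
        ∏ x ∈ Kᶜ, (if x ∈ s \ K then w x else 1 - w x) =
        ∑ U ∈ Kᶜ.powerset, ∏ x ∈ Kᶜ, (if x ∈ U then w x else 1 - w x) := by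
      refine Finset.sum_nbij' (fun s => s \ K) (fun U => T ∪ U) ?_ ?_ ?_ ?_ ?_
      · intro s _
        exact Finset.mem_powerset.2 fun x hx => Finset.mem_compl.2 (Finset.mem_sdiff.1 hx).2
      · intro U hU
        have hUK : U ⊆ Kᶜ := Finset.mem_powerset.1 hU
        refine Finset.mem_filter.2 ⟨Finset.mem_univ _, ?_⟩
        ext x
        simp only [Finset.mem_inter, Finset.mem_union]
        constructor
        · rintro ⟨hx | hx, hxK⟩
          · exact hx
          · exact absurd hxK (Finset.mem_compl.1 (hUK hx))
        · intro hx; exact ⟨Or.inl hx, hTK hx⟩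
      · intro s hs
        have hsT : s ∩ K = T := (Finset.mem_filter.1 hs).2
        show T ∪ s \ K = s
        rw [← hsT]
        ext x
        simp only [Finset.mem_union, Finset.mem_sdiff, Finset.mem_inter]
        tauto
      · intro U hU
        have hUK : U ⊆ Kᶜ := Finset.mem_powerset.1 hU
        show (T ∪ U) \ K = U
        ext x
        simp only [Finset.mem_sdiff, Finset.mem_union]
        constructor
        · rintro ⟨hx | hx, hxK⟩
          · exact absurd (hTK hx) hxK
          · exact hx
        · intro hx; exact ⟨Or.inr hx, Finset.mem_compl.1 (hUK hx)⟩
      · intro s _; rfl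
    rw [hbij, IndepBlob.sum_powerset_prod_ite_mem]
    exact Finset.prod_eq_one fun x _ => by ring
  rw [hone, mul_one]

/-- Membership in the image of a finset of the subtype `↥K` under the inclusion. [folklore] -/
theorem mem_map_subtype_iff (K : Finset (Fin n)) (T : Finset K) (k : K) :
    ((k : Fin n) ∈ T.map (Function.Embedding.subtype _)) ↔ k ∈ T := by
  constructor
  · intro h
    obtain ⟨k', hk', hkk'⟩ := Finset.mem_map.1 h
    have : k' = k := Subtype.ext (by simpa using hkk')
    exact this ▸ hk'
  · intro h
    exact Finset.mem_map.2 ⟨k, h, rfl⟩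

/-- **Re-indexing `K.powerset` by the finsets of the subtype `↥K`.** [folklore] -/
theorem sum_powerset_eq_sum_finset_subtype (K : Finset (Fin n)) (Φ : Finset (Fin n) → ℝ) :
    ∑ T ∈ K.powerset, Φ T = ∑ T : Finset K, Φ (T.map (Function.Embedding.subtype _)) := by
  refine Finset.sum_nbij' (fun T => T.subtype (· ∈ K)) (fun T => T.map (Function.Embedding.subtype _)) ?_ ?_ ?_ ?_ ?_
  · intro T _; exact Finset.mem_univ _
  · intro T _; exact Finset.mem_powerset.2 fun x hx => by
      obtain ⟨k, _, rfl⟩ := Finset.mem_map.1 hx; exact k.2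
  · intro T hT; exact Finset.subtype_map_of_mem fun x hx => Finset.mem_powerset.1 hT hx
  · intro T _
    ext k
    rw [Finset.mem_subtype, mem_map_subtype_iff]
  · intro T hT
    show Φ T = Φ ((T.subtype (· ∈ K)).map (Function.Embedding.subtype _))
    rw [Finset.subtype_map_of_mem fun x hx => Finset.mem_powerset.1 hT hx]

/-- **The block tail as an independent-blob sum on `↥K`.**  For gates `q` on `Fin n`, block coordinates `K` with sizes `size` and a level `y`:
`P(y ≤ Σ_{x∈K, x∈ω} size x) = Σ_{T : Finset ↥K, y ≤ Σ_{k∈T} size k} ∏_{k : ↥K} (q k if k ∈ T else 1 − q k)`. [this work] -/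
theorem real_blockTail_eq_sum_subtype (q : Fin n → unitInterval) (K : Finset (Fin n)) (size : Fin n → ℕ) (y : ℕ) :
    (prodBernoulli q).real {ω : Set (Fin n) | y ≤ ∑ x ∈ K.filter (fun x => x ∈ ω), size x} =
      ∑ T ∈ (Finset.univ : Finset (Finset K)).filter (fun T : Finset K => y ≤ ∑ k ∈ T, size k),
        ∏ k : K, (if k ∈ T then ((q k : unitInterval) : ℝ) else 1 - ((q k : unitInterval) : ℝ)) := by
  rw [IndepBlob.prodBernoulli_real_eq_sum_finset q]
  -- the event is a functional of `s ∩ K`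
  have hev : ∀ s : Finset (Fin n),
      ((↑s : Set (Fin n)) ∈ {ω : Set (Fin n) | y ≤ ∑ x ∈ K.filter (fun x => x ∈ ω), size x}) ↔ y ≤ ∑ x ∈ s ∩ K, size x := by
    intro s
    simp only [Set.mem_setOf_eq, Finset.mem_coe]
    rw [show K.filter (fun x => x ∈ s) = s ∩ K from by ext x; simp [Finset.mem_inter, and_comm]]
  rw [Finset.sum_filter]
  simp_rw [hev]
  have h1 : ∑ s : Finset (Fin n), (if y ≤ ∑ x ∈ s ∩ K, size x then
        ∏ x, (if x ∈ s then ((q x : unitInterval) : ℝ) else 1 - ((q x : unitInterval) : ℝ)) else 0) =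
      ∑ s : Finset (Fin n), (fun T : Finset (Fin n) => if y ≤ ∑ x ∈ T, size x then (1 : ℝ) else 0) (s ∩ K) *
        ∏ x, (if x ∈ s then ((q x : unitInterval) : ℝ) else 1 - ((q x : unitInterval) : ℝ)) := by
    refine Finset.sum_congr rfl fun s _ => ?_
    simp only
    split_ifs <;> simp
  rw [h1, sum_weight_eq_sum_powerset_inter K (fun x => ((q x : unitInterval) : ℝ))
    (fun T : Finset (Fin n) => if y ≤ ∑ x ∈ T, size x then (1 : ℝ) else 0), sum_powerset_eq_sum_finset_subtype, Finset.sum_filter]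
  refine Finset.sum_congr rfl fun T _ => ?_
  have hsum : ∑ x ∈ T.map (Function.Embedding.subtype _), size x = ∑ k ∈ T, size (k : Fin n) := Finset.sum_map _ _ _
  have hprod : ∏ x ∈ K, (if x ∈ T.map (Function.Embedding.subtype _) then ((q x : unitInterval) : ℝ) else 1 - ((q x : unitInterval) : ℝ)) =
      ∏ k : K, (if k ∈ T then ((q k : unitInterval) : ℝ) else 1 - ((q k : unitInterval) : ℝ)) := by
    rw [Finset.prod_subtype K (p := fun x => x ∈ K) (fun _ => Iff.rfl)]
    refine Finset.prod_congr rfl fun k _ => ?_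
    simp only [mem_map_subtype_iff K T k]
  simp only [hsum, hprod]
  split_ifs <;> simp

/-- **Shifted form** (the conjecture's `j + 1 − b`): `P(y − M ≤ W) = Σ_{T : y ≤ M + Σ_T size} ∏ (…)`, natural subtraction on both sides. [this work] -/
theorem real_blockTail_shift_eq_sum_subtype (q : Fin n → unitInterval) (K : Finset (Fin n)) (size : Fin n → ℕ) (y M : ℕ) :
    (prodBernoulli q).real {ω : Set (Fin n) | y - M ≤ ∑ x ∈ K.filter (fun x => x ∈ ω), size x} =
      ∑ T ∈ (Finset.univ : Finset (Finset K)).filter (fun T : Finset K => y ≤ M + ∑ k ∈ T, size k),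
        ∏ k : K, (if k ∈ T then ((q k : unitInterval) : ℝ) else 1 - ((q k : unitInterval) : ℝ)) := by
  rw [real_blockTail_eq_sum_subtype]
  refine Finset.sum_congr ?_ fun _ _ => rfl
  ext T
  simp only [Finset.mem_filter, Finset.mem_univ, true_and]
  omega

end Quant

end Summit.CriticalPhenomena.PercolationContinuityZ3.Theorems

end
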